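import Literature.NumberTheory.EllipticCurves.FineSelmerLimThm35AtTwoUpstairsProofs

/-! crux-triage seat 2 GEN 45 — by-name check that the v19 stub conjunct `Lim-up`
(`Lim2017.thm35_at_two_upstairs_fineSelmer_twoTorsion_finite_of_classicalMuVanishes`, the name in the registered/drafted
`stub_lemma46_limUp.2` and in Cert42's `s7`) is CLOSED by w2's p716773 `_holds`, hypothesis-free. -/

example : Literature.NumberTheory.EllipticCurves.Lim2017.thm35_at_two_upstairs_fineSelmer_twoTorsion_finite_of_classicalMuVanishes :=
  Literature.NumberTheory.EllipticCurves.Lim2017.thm35_at_two_upstairs_fineSelmer_twoTorsion_finite_of_classicalMuVanishes_holds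

/-- named copy for `#print axioms`. [folklore] -/
theorem limUp_closed_byName :
    Literature.NumberTheory.EllipticCurves.Lim2017.thm35_at_two_upstairs_fineSelmer_twoTorsion_finite_of_classicalMuVanishes :=
  Literature.NumberTheory.EllipticCurves.Lim2017.thm35_at_two_upstairs_fineSelmer_twoTorsion_finite_of_classicalMuVanishes_holds
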